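import Literature.MathematicalPhysics.QuantumFieldTheory.BalabanImbrieJaffe1984to88.BIJ88ZtPositivity308

/-!
# `BalabanImbrieJaffe1984to88.BIJ88GaussShellNoncentred309` — T. Bałaban, J. Imbrie, A. Jaffe, *Effective action and cluster properties of the
abelian Higgs model*, Commun. Math. Phys. **114** (1988) 257–315 [BalabanImbrieJaffe1988], Sect. 5.14 p. 309 [PDF 53], the located sentences
*"the n-th derivative in t of χ(cp(e_k), A^{(k)}) [sic; = χ(cp(te_k), A^{(k)})] is bounded by t^{−n} times a function bounded by a constant and
supported in c₁p(te_k) ≤ |A^{(k)}| ≤ c₂p(te_k). After integration over A^{(k)}, we obtain factors ct^{−n}e^{−cp(te_k)²} … Similar bounds hold for φ^{(k)}"*,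
read for the ACTUAL fluctuation measure of (5.14.3), p. 304: *"The expectation ⟨ ⟩_1 is in the measure (1/N)∫dΦ … exp[½⟨Φ,ΔΦ⟩ + ⟨Φ,ℱ⟩]"*
(sic — the print carries no minus sign: its Δ is the negative of the positive-definite form `Δ` fed to this lineage's `fieldLaw`, cf. (5.13.2)) —
a Gaussian measure WITH A MEAN (`Δ⁻¹ℱ`, p. 305: *"integration by parts replaces Φ by C_s(δ/δΦ) + C_sℱ"*): **THE GAUSSIAN SHELL FACTOR FOR
NON-CENTRED GAUSSIAN FIELDS**.  Gens 5/7 of this seat (`BIJ88GaussIntegration309Law`, `BIJ88RestrictionsAllOrders308`) proved the sentence for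
CENTRED Gaussian marginals; here the centring is dropped.

statement-level skeleton of published theorems with citation tags; proofs where landed; nothing here is a claim about the Yang–Mills mass gap

PDF held: `paper:balaban1988-cmp114-bij-abelian-higgs-effective-action` (journal page = PDF page + 256); pp. 304–305, 309 = PDF 48–49, 53 re-read
this generation (`p0053.txt` L1–12; `p0049.txt` L1–3).

WHAT IS REPRODUCED (unit `lit-balaban-p36`, generation 12 of the Phase-2 proof seat p36, file 2 of 3; SKELETON rows **C2.Eq5.14.3-5.14.4** (the p. 309
sentence, member) and **C2.Eq5.14.1-5.14.2** (`z_t > 0`, member) of `HOME/lit-balaban-r16/ROWS-C2-part2.md`, owner r16, heads untouched; HOME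
`run/shared/lean/pub/lit-balaban/`).  Theorems only (0 definitions, 0 `Prop` facts):
* §1 **`real_abs_ge_le_of_hasGaussianLaw_meanBound`**: for ANY real observable with Gaussian law, `|E X| ≤ μ₀`, `Var X ≤ v` (`0 < v`), and every
  `a ≥ 0`: `P{a ≤ |X|} ≤ 2e^{μ₀²/(2v)}·e^{−a²/(4v)}` — a sub-Gaussian tail of the SAME SHAPE as the centred one (gen 7's
  `real_abs_ge_le_of_hasGaussianLaw` handles `a ≥ |E X|` only).
* §2 THE p. 309 SENTENCE UNDER AN ABSTRACT SUB-GAUSSIAN TAIL `P{a ≤ |Φ_b|} ≤ A e^{−κa²}` (`A, κ ≥ 0`): **`integral_abs_iteratedDeriv_prod_cutoff_t_le_of_tail`**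
  (`∫|(d/dt)ⁿχ′_{Λ,t}| dμ ≤ (NĈ)ⁿt^{−n}·N·A·e^{−κ(81/100)c₀²p(te_k)²}`, any finite measure, `|c_b| ≥ c₀ > 0`), and for `κ > 0`, `p > 1/2` its
  consequence **`tendsto_integral_abs_iteratedDeriv_prod_cutoff_t_zero_of_tail`** (`∫|(d/dt)ⁱχ′_{Λ,t}| dμ → 0` as `t → 0⁺`, `i ≥ 1`) — the
  hypothesis `hL1` of the sibling file `BIJ88RestrictionsL1Decay308`.
* §3 GAUSSIAN FIELDS WITH MEANS: **`integral_abs_iteratedDeriv_prod_cutoff_t_le_of_hasGaussianLaw_meanBound`** (the printed `ct^{−n}e^{−cp(te_k)²}` with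
  `c = (81/400)c₀²/v` and the prefactor `2Ne^{μ₀²/(2v)}`), and **`tendsto_integral_abs_iteratedDeriv_prod_cutoff_t_zero_of_hasGaussianLaw`**: for ANY
  finite family of real observables with Gaussian laws — no centring, no variance hypothesis (`μ₀ := Σ_b|EΦ_b|`, `v := 1 + Σ_b Var Φ_b` are
  automatic) — `hL1` holds.
* §4 `z_t > 0` FOR NON-CENTRED JOINTLY GAUSSIAN FIELDS whose means lie in the small-field box `|E Φ_b| < (9/10)c₀`:
  `measureReal_smallBall_pos_of_hasGaussianLaw_mean`, `integral_restrictedInteraction_pos_of_mean`, `integral_restrictedInteraction_ne_zero_Ioc_of_mean`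
  (gen 8's `BIJ88ZtPositivity308` with `h0` replaced by the box condition on the mean vector).
HONEST SCOPE: (a) the constants `1/4`, `81/400` are convenient, not optimal; (b) §4 needs the means INSIDE the box (a degenerate Gaussian concentrated
outside it gives `z_t`-positivity no purchase) — in the §5.13 model positivity is structural instead (`BIJ88SlotMomentsGauss308.zG_fD_empty_pos`).
0 `sorry`, 0 definitions, 0 new `Prop` facts (D-0026); imports `BIJ88ZtPositivity308` only; modifies nothing.  NOT summit progress; NOT continuum;
NOT Clay.  Cell `lit-balaban` Phase 2, seat p36 gen 12 (owner r16, referee ref-5).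
-/

namespace Literature.MathematicalPhysics.QuantumFieldTheory.BalabanImbrieJaffe1984to88.BIJ88GaussShellNoncentred309

open MeasureTheory ProbabilityTheory Filter Set
open scoped Topology
open BIJ88Sect2Statements (pLog)
open BIJ88Sect5Statements (CutoffProfile cutoff)
open BIJ88GaussIntegration309Law (real_abs_ge_le_of_hasGaussianLaw)
open BIJ88GaussIntegration309Product (integral_abs_iteratedDeriv_prod_cutoff_t_le_measureReal)

/-! ## §1 The tail of a non-centred real Gaussian -/

section Tail

variable {Ω : Type*} [MeasurableSpace Ω] {P : Measure Ω}

/-- **Non-centred Gaussian tail**: for ANY real observable `X` with Gaussian law on ANY probability space, `|E X| ≤ μ₀`, `Var X ≤ v`, `0 < v`, and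
every `a ≥ 0`: `P{a ≤ |X|} ≤ 2e^{μ₀²/(2v)}·e^{−a²/(4v)}` (for `a² ≤ 2μ₀²` the right side is `≥ 2`; otherwise `a > μ₀ ≥ |E X|`, the centred bound
`2e^{−(a−|EX|)²/(2Var X)}` of gen 7 applies and `(a−μ₀)² ≥ a²/2 − μ₀²`; a degenerate law `δ_{EX}` gives `0`).
[cite: BalabanImbrieJaffe1988, (5.14.4) p.309] -/
theorem real_abs_ge_le_of_hasGaussianLaw_meanBound {X : Ω → ℝ} (hX : HasGaussianLaw X P) (hXm : Measurable X) {μ₀ v : ℝ}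
    (hm : |P[X]| ≤ μ₀) (hv : 0 < v) (hvar : Var[X; P] ≤ v) {a : ℝ} (ha : 0 ≤ a) :
    P.real {ω | a ≤ |X ω|} ≤ 2 * Real.exp (μ₀ ^ 2 / (2 * v)) * Real.exp (-(a ^ 2 / (4 * v))) := by
  haveI := hX.isProbabilityMeasure
  have hμ₀ : 0 ≤ μ₀ := (abs_nonneg _).trans hm
  by_cases hsmall : a ^ 2 ≤ 2 * μ₀ ^ 2
  · -- trivial regime: the bound is ≥ 2 ≥ 1 ≥ P
    have hP1 : P.real {ω | a ≤ |X ω|} ≤ 1 := (measureReal_mono (Set.subset_univ _)).trans (le_of_eq probReal_univ)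
    refine hP1.trans ?_
    rw [mul_assoc, ← Real.exp_add]
    have hexp : 0 ≤ μ₀ ^ 2 / (2 * v) + -(a ^ 2 / (4 * v)) := by
      have : μ₀ ^ 2 / (2 * v) + -(a ^ 2 / (4 * v)) = (2 * μ₀ ^ 2 - a ^ 2) / (4 * v) := by field_simp; ring
      rw [this]
      exact div_nonneg (by linarith) (by positivity)
    have h1 : (1 : ℝ) ≤ Real.exp (μ₀ ^ 2 / (2 * v) + -(a ^ 2 / (4 * v))) := Real.one_le_exp hexp
    linarith
  · rw [not_le] at hsmall
    have hsq : μ₀ ^ 2 < a ^ 2 := by nlinarith [sq_nonneg μ₀]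
    have hμa : μ₀ < a := (le_abs_self μ₀).trans_lt (abs_lt_of_sq_lt_sq hsq ha)
    -- the target dominates the shifted centred bound
    have hRHS : 2 * Real.exp (-((a - μ₀) ^ 2 / (2 * v))) ≤ 2 * Real.exp (μ₀ ^ 2 / (2 * v)) * Real.exp (-(a ^ 2 / (4 * v))) := by
      rw [mul_assoc, ← Real.exp_add]
      refine mul_le_mul_of_nonneg_left (Real.exp_le_exp.mpr ?_) (by norm_num)
      have key : μ₀ ^ 2 / (2 * v) + -(a ^ 2 / (4 * v)) - (-((a - μ₀) ^ 2 / (2 * v))) = (a - 2 * μ₀) ^ 2 / (4 * v) := by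
        field_simp; ring
      have : 0 ≤ (a - 2 * μ₀) ^ 2 / (4 * v) := by positivity
      linarith
    by_cases hV : Var[X; P] = 0
    · -- degenerate marginal: the law is δ_{E X} and |E X| ≤ μ₀ < a
      have hT : MeasurableSet {x : ℝ | a ≤ |x|} := measurableSet_le measurable_const continuous_abs.measurable
      have hmap : P.map X = Measure.dirac (P[X]) := by
        rw [hX.map_eq_gaussianReal, hV, Real.toNNReal_zero, gaussianReal_zero_var]
      have hzero : P.real {ω | a ≤ |X ω|} = 0 := by
        rw [measureReal_def, show {ω | a ≤ |X ω|} = X ⁻¹' {x : ℝ | a ≤ |x|} from rfl, ← Measure.map_apply hXm hT, hmap,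
          Measure.dirac_apply' _ hT, Set.indicator_of_notMem]
        · simp
        · simp only [Set.mem_setOf_eq, not_le]; exact lt_of_le_of_lt hm hμa
      rw [hzero]; positivity
    · have hVpos : 0 < Var[X; P] := lt_of_le_of_ne (variance_nonneg _ _) (Ne.symm hV)
      have h := real_abs_ge_le_of_hasGaussianLaw hX hXm (a := a) (hm.trans hμa.le)
      refine h.trans (le_trans ?_ hRHS)
      refine mul_le_mul_of_nonneg_left (Real.exp_le_exp.mpr ?_) (by norm_num)
      have h1 : (a - μ₀) ^ 2 ≤ (a - |P[X]|) ^ 2 := pow_le_pow_left₀ (by linarith) (by linarith [hm]) 2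
      have h2 : (a - μ₀) ^ 2 / (2 * v) ≤ (a - μ₀) ^ 2 / (2 * Var[X; P]) :=
        div_le_div_of_nonneg_left (by positivity) (by positivity) (by linarith)
      have h3 : (a - μ₀) ^ 2 / (2 * Var[X; P]) ≤ (a - |P[X]|) ^ 2 / (2 * Var[X; P]) :=
        div_le_div_of_nonneg_right h1 (by positivity)
      rw [neg_div, neg_le_neg_iff]
      exact h2.trans h3

/-- The same with the prefactor of the abstract shape `A·e^{−κa²}`, `A = 2e^{μ₀²/(2v)}`, `κ = 1/(4v)`. [cite: BalabanImbrieJaffe1988, (5.14.4) p.309] -/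
theorem real_abs_ge_le_of_hasGaussianLaw_meanBound' {X : Ω → ℝ} (hX : HasGaussianLaw X P) (hXm : Measurable X) {μ₀ v : ℝ}
    (hm : |P[X]| ≤ μ₀) (hv : 0 < v) (hvar : Var[X; P] ≤ v) {a : ℝ} (ha : 0 ≤ a) :
    P.real {ω | a ≤ |X ω|} ≤ 2 * Real.exp (μ₀ ^ 2 / (2 * v)) * Real.exp (-(1 / (4 * v) * a ^ 2)) := by
  have h := real_abs_ge_le_of_hasGaussianLaw_meanBound hX hXm hm hv hvar ha
  rwa [show a ^ 2 / (4 * v) = 1 / (4 * v) * a ^ 2 by ring] at h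

end Tail

/-! ## §2 The p. 309 sentence under an abstract sub-Gaussian tail -/

section AbstractTail

variable {Ω : Type*} [MeasurableSpace Ω] (χ : CutoffProfile)

/-- **p. 309 for the whole χ′ under a sub-Gaussian marginal tail** (*"After integration over A^{(k)}, we obtain factors ct^{−n}e^{−cp(te_k)²}"*): for
`n₀ ≥ 1` there is `Ĉ = Ĉ(χ,p,n₀) ≥ 1` such that on every finite measure space, for every finite family `B` (`N = |B|`) of measurable real
observables with `P{a ≤ |Φ_b|} ≤ A e^{−κa²}` for all `a ≥ 0` (`A, κ ≥ 0`), thresholds `|c_b| ≥ c₀ > 0`, all `0 < e_k`, `0 < t`, `te_k ≤ e^{−1}`,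
`1 ≤ n ≤ n₀`: `∫ |(d/dt)ⁿ Π_{b∈B} χ(c_b·p(te_k), Φ_b)| dμ ≤ (N·Ĉ)ⁿ t^{−n} · N·A·e^{−κ(81/100)c₀²·p(te_k)²}`.
[cite: BalabanImbrieJaffe1988, (5.14.4) p.309] -/
theorem integral_abs_iteratedDeriv_prod_cutoff_t_le_of_tail {ι : Type*} (p : ℝ) (n₀ : ℕ) :
    ∃ C : ℝ, 1 ≤ C ∧ ∀ (μ : Measure Ω) [IsFiniteMeasure μ] (B : Finset ι) (Φ : ι → Ω → ℝ) (c : ι → ℝ) (c₀ A κ : ℝ),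
      (∀ b ∈ B, Measurable (Φ b)) → 0 ≤ A → 0 ≤ κ →
      (∀ b ∈ B, ∀ a : ℝ, 0 ≤ a → μ.real {ω | a ≤ |Φ b ω|} ≤ A * Real.exp (-(κ * a ^ 2))) →
      0 < c₀ → (∀ b ∈ B, c₀ ≤ |c b|) →
      ∀ ⦃ek t : ℝ⦄, 0 < ek → 0 < t → t * ek ≤ Real.exp (-1) → ∀ n, 1 ≤ n → n ≤ n₀ →
        ∫ ω, |iteratedDeriv n (fun s => ∏ b ∈ B, cutoff χ (c b * pLog p (s * ek)) (Φ b ω)) t| ∂μ ≤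
          ((B.card : ℝ) * C) ^ n * t ^ (-(n : ℤ)) *
            (B.card * A * Real.exp (-(κ * (81 / 100 * c₀ ^ 2) * pLog p (t * ek) ^ 2))) := by
  obtain ⟨C, hC1, hC⟩ := integral_abs_iteratedDeriv_prod_cutoff_t_le_measureReal (ι := ι) (Ω := Ω) χ p n₀
  refine ⟨C, hC1, ?_⟩
  intro μ _ B Φ c c₀ A κ hΦ hA hκ htail hc₀ hcb ek t hek ht h1 n hn1 hn
  have hcne : ∀ b ∈ B, c b ≠ 0 := fun b hb h => by
    have := hcb b hb; rw [h, abs_zero] at this; linarith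
  have hmain := hC μ B Φ c hΦ hcne hek ht h1 n hn1 hn
  have hK : 0 ≤ ((B.card : ℝ) * C) ^ n * t ^ (-(n : ℤ)) :=
    mul_nonneg (pow_nonneg (mul_nonneg (Nat.cast_nonneg _) (by linarith)) _) (zpow_pos ht _).le
  refine hmain.trans (mul_le_mul_of_nonneg_left ?_ hK)
  have hP : 0 ≤ pLog p (t * ek) := Real.rpow_nonneg (abs_nonneg _) p
  have hb : ∀ b ∈ B, μ.real {ω | 9 / 10 * (|c b| * pLog p (t * ek)) ≤ |Φ b ω|} ≤
      A * Real.exp (-(κ * (81 / 100 * c₀ ^ 2) * pLog p (t * ek) ^ 2)) := by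
    intro b hbB
    have ha : 0 ≤ 9 / 10 * (|c b| * pLog p (t * ek)) := by positivity
    refine (htail b hbB _ ha).trans (mul_le_mul_of_nonneg_left (Real.exp_le_exp.mpr ?_) hA)
    rw [neg_le_neg_iff]
    have hcc : c₀ ^ 2 ≤ c b ^ 2 := by
      have := pow_le_pow_left₀ hc₀.le (hcb b hbB) 2; rwa [sq_abs] at this
    have hp2 : 0 ≤ pLog p (t * ek) ^ 2 := by positivity
    have : (9 / 10 * (|c b| * pLog p (t * ek))) ^ 2 = 81 / 100 * c b ^ 2 * pLog p (t * ek) ^ 2 := by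
      rw [mul_pow, mul_pow, sq_abs]; ring
    rw [this, mul_assoc κ]
    refine mul_le_mul_of_nonneg_left ?_ hκ
    nlinarith [mul_le_mul_of_nonneg_right hcc hp2]
  calc ∑ b ∈ B, μ.real {ω | 9 / 10 * (|c b| * pLog p (t * ek)) ≤ |Φ b ω|}
      ≤ ∑ _b ∈ B, A * Real.exp (-(κ * (81 / 100 * c₀ ^ 2) * pLog p (t * ek) ^ 2)) := Finset.sum_le_sum hb
    _ = B.card * A * Real.exp (-(κ * (81 / 100 * c₀ ^ 2) * pLog p (t * ek) ^ 2)) := by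
        rw [Finset.sum_const, nsmul_eq_mul]; ring

/-- **The L¹ decay of the restriction derivatives under a sub-Gaussian marginal tail with `κ > 0`** (`p > 1/2`, `|c_b| ≥ c₀ > 0`, `e_k > 0`,
`i ≥ 1`): `∫ |(d/dt)ⁱχ′_{Λ,t}| dμ → 0` as `t → 0⁺` — `t^{−i}e^{−κ′p(te_k)²} → 0` by gen 7's `BIJ88RestrictionsAllOrders308.tendsto_zpow_mul_exp_neg_pLog_sq`;
this is the hypothesis `hL1` of `BIJ88RestrictionsL1Decay308`. [cite: BalabanImbrieJaffe1988, (5.14.4) p.309] -/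
theorem tendsto_integral_abs_iteratedDeriv_prod_cutoff_t_zero_of_tail {ι : Type*} {p : ℝ} (hp : 1 / 2 < p) (μ : Measure Ω)
    [IsFiniteMeasure μ] (B : Finset ι) {Φ : ι → Ω → ℝ} (hΦ : ∀ b ∈ B, Measurable (Φ b)) {A κ : ℝ} (hA : 0 ≤ A) (hκ : 0 < κ)
    (htail : ∀ b ∈ B, ∀ a : ℝ, 0 ≤ a → μ.real {ω | a ≤ |Φ b ω|} ≤ A * Real.exp (-(κ * a ^ 2)))
    {c : ι → ℝ} {c₀ : ℝ} (hc₀ : 0 < c₀) (hcb : ∀ b ∈ B, c₀ ≤ |c b|) {ek : ℝ} (hek : 0 < ek) {i : ℕ} (hi : 1 ≤ i) :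
    Tendsto (fun t => ∫ ω, |iteratedDeriv i (fun s => ∏ b ∈ B, cutoff χ (c b * pLog p (s * ek)) (Φ b ω)) t| ∂μ)
      (𝓝[>] (0 : ℝ)) (𝓝 0) := by
  obtain ⟨C, -, hC⟩ := integral_abs_iteratedDeriv_prod_cutoff_t_le_of_tail (ι := ι) (Ω := Ω) χ p i
  have hκ' : 0 < κ * (81 / 100 * c₀ ^ 2) := by positivity
  refine squeeze_zero' (g := fun t => ((B.card : ℝ) * C) ^ i * (B.card * A) *
      (t ^ (-(i : ℤ)) * Real.exp (-(κ * (81 / 100 * c₀ ^ 2) * pLog p (t * ek) ^ 2))))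
    (Filter.Eventually.of_forall fun t => integral_nonneg fun ω => abs_nonneg _) ?_ ?_
  · filter_upwards [BIJ88RestrictedInteraction308.eventually_branch ek] with t ht
    refine (hC μ B Φ c c₀ A κ hΦ hA hκ.le htail hc₀ hcb hek ht.1 ht.2.2.le i hi le_rfl).trans (le_of_eq ?_)
    ring
  · have h := (BIJ88RestrictionsAllOrders308.tendsto_zpow_mul_exp_neg_pLog_sq hκ' hp hek i).const_mul
      (((B.card : ℝ) * C) ^ i * (B.card * A))
    rw [mul_zero] at h
    exact h

end AbstractTail

/-! ## §3 Gaussian fields with means -/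

section Gaussian

variable {Ω : Type*} [MeasurableSpace Ω] (χ : CutoffProfile)

/-- **p. 309 for the whole χ′, Gaussian marginals WITH MEANS**: for `n₀ ≥ 1` there is `Ĉ ≥ 1` such that on every probability space, for every
finite family `B` (`N = |B|`) of measurable real observables with Gaussian laws, `|E Φ_b| ≤ μ₀`, `Var Φ_b ≤ v` (`0 < v`), thresholds `|c_b| ≥ c₀ > 0`,
all `0 < e_k`, `0 < t`, `te_k ≤ e^{−1}`, `1 ≤ n ≤ n₀`:
`∫ |(d/dt)ⁿ Π_{b∈B} χ(c_b·p(te_k), Φ_b)| dP ≤ (N·Ĉ)ⁿ t^{−n} · N·2e^{μ₀²/(2v)}·e^{−(81/400)(c₀²/v)·p(te_k)²}` — the printed `ct^{−n}e^{−cp(te_k)²}` with no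
centring (gen 7's `BIJ88GaussIntegration309Law.integral_abs_iteratedDeriv_prod_cutoff_t_le_of_hasGaussianLaw` is the case `μ₀ = 0` up to constants).
[cite: BalabanImbrieJaffe1988, (5.14.4) p.309] -/
theorem integral_abs_iteratedDeriv_prod_cutoff_t_le_of_hasGaussianLaw_meanBound {ι : Type*} (p : ℝ) (n₀ : ℕ) :
    ∃ C : ℝ, 1 ≤ C ∧ ∀ (P : Measure Ω) [IsProbabilityMeasure P] (B : Finset ι) (Φ : ι → Ω → ℝ) (c : ι → ℝ) (c₀ μ₀ v : ℝ),
      (∀ b ∈ B, HasGaussianLaw (Φ b) P) → (∀ b ∈ B, Measurable (Φ b)) → (∀ b ∈ B, |P[Φ b]| ≤ μ₀) →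
      0 < v → (∀ b ∈ B, Var[Φ b; P] ≤ v) → 0 < c₀ → (∀ b ∈ B, c₀ ≤ |c b|) →
      ∀ ⦃ek t : ℝ⦄, 0 < ek → 0 < t → t * ek ≤ Real.exp (-1) → ∀ n, 1 ≤ n → n ≤ n₀ →
        ∫ ω, |iteratedDeriv n (fun s => ∏ b ∈ B, cutoff χ (c b * pLog p (s * ek)) (Φ b ω)) t| ∂P ≤
          ((B.card : ℝ) * C) ^ n * t ^ (-(n : ℤ)) *
            (B.card * (2 * Real.exp (μ₀ ^ 2 / (2 * v))) * Real.exp (-(1 / (4 * v) * (81 / 100 * c₀ ^ 2) * pLog p (t * ek) ^ 2))) := by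
  obtain ⟨C, hC1, hC⟩ := integral_abs_iteratedDeriv_prod_cutoff_t_le_of_tail (ι := ι) (Ω := Ω) χ p n₀
  refine ⟨C, hC1, ?_⟩
  intro P _ B Φ c c₀ μ₀ v hG hΦ hm hv hvar hc₀ hcb ek t hek ht h1 n hn1 hn
  exact hC P B Φ c c₀ (2 * Real.exp (μ₀ ^ 2 / (2 * v))) (1 / (4 * v)) hΦ (by positivity) (by positivity)
    (fun b hb a ha => real_abs_ge_le_of_hasGaussianLaw_meanBound' (hG b hb) (hΦ b hb) (hm b hb) hv (hvar b hb) ha) hc₀ hcb hek ht h1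
    n hn1 hn

/-- For a finite family the means and variances are bounded: `|E Φ_b| ≤ Σ_{b′∈Λ}|E Φ_{b′}|`, `Var Φ_b ≤ 1 + Σ_{b′∈Λ} Var Φ_{b′}` (`b ∈ Λ`).
[cite: BalabanImbrieJaffe1988, (5.14.4) p.309] -/
theorem mean_var_le_sum (P : Measure Ω) {ι : Type*} (B : Finset ι) (Φ : ι → Ω → ℝ) :
    (∀ b ∈ B, |P[Φ b]| ≤ ∑ b' ∈ B, |P[Φ b']|) ∧ 0 < 1 + ∑ b' ∈ B, Var[Φ b'; P] ∧
      ∀ b ∈ B, Var[Φ b; P] ≤ 1 + ∑ b' ∈ B, Var[Φ b'; P] := by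
  have hvn : ∀ b ∈ B, 0 ≤ Var[Φ b; P] := fun b _ => variance_nonneg _ _
  refine ⟨fun b hb => Finset.single_le_sum (fun b' _ => abs_nonneg (P[Φ b'])) hb, by have := Finset.sum_nonneg hvn; linarith,
    fun b hb => ?_⟩
  have := Finset.single_le_sum hvn hb
  linarith

/-- **`hL1` FOR ANY FINITE FAMILY OF GAUSSIAN-LAW MARGINALS — no centring, no variance hypothesis**: on a probability space, for `Φ_b`, `b ∈ Λ`,
measurable with Gaussian laws (Mathlib `HasGaussianLaw`; ANY means), thresholds `|c_b| ≥ c₀ > 0`, `p > 1/2`, `e_k > 0` and `i ≥ 1`: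
`∫ |(d/dt)ⁱχ′_{Λ,t}| dP → 0` as `t → 0⁺` — *"After integration over A^{(k)}, we obtain factors ct^{−n}e^{−cp(te_k)²}"* for the actual, non-centred,
Gaussian expectation of (5.14.3). [cite: BalabanImbrieJaffe1988, (5.14.4) p.309] -/
theorem tendsto_integral_abs_iteratedDeriv_prod_cutoff_t_zero_of_hasGaussianLaw {ι : Type*} {p : ℝ} (hp : 1 / 2 < p) (P : Measure Ω)
    [IsProbabilityMeasure P] (B : Finset ι) {Φ : ι → Ω → ℝ} (hG : ∀ b ∈ B, HasGaussianLaw (Φ b) P) (hΦ : ∀ b ∈ B, Measurable (Φ b))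
    {c : ι → ℝ} {c₀ : ℝ} (hc₀ : 0 < c₀) (hcb : ∀ b ∈ B, c₀ ≤ |c b|) {ek : ℝ} (hek : 0 < ek) {i : ℕ} (hi : 1 ≤ i) :
    Tendsto (fun t => ∫ ω, |iteratedDeriv i (fun s => ∏ b ∈ B, cutoff χ (c b * pLog p (s * ek)) (Φ b ω)) t| ∂P)
      (𝓝[>] (0 : ℝ)) (𝓝 0) := by
  obtain ⟨hm, hv, hvar⟩ := mean_var_le_sum P B Φ
  exact tendsto_integral_abs_iteratedDeriv_prod_cutoff_t_zero_of_tail χ hp P B hΦ (A := 2 * Real.exp ((∑ b' ∈ B, |P[Φ b']|) ^ 2 /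
      (2 * (1 + ∑ b' ∈ B, Var[Φ b'; P])))) (κ := 1 / (4 * (1 + ∑ b' ∈ B, Var[Φ b'; P]))) (by positivity) (by positivity)
    (fun b hb a ha => real_abs_ge_le_of_hasGaussianLaw_meanBound' (hG b hb) (hΦ b hb) (hm b hb) hv (hvar b hb) ha) hc₀ hcb hek hi

/-- The same for JOINTLY Gaussian fields (Mathlib `HasGaussianLaw` of `ω ↦ (Φ_b ω)_{b∈Λ}`; the marginals are then Gaussian) and positive
thresholds `c_b ≥ c₀ > 0` — the form used by the p. 308 chain. [cite: BalabanImbrieJaffe1988, (5.14.4) p.309] -/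
theorem tendsto_integral_abs_iteratedDeriv_prod_cutoff_t_zero_of_joint {ι : Type*} {p : ℝ} (hp : 1 / 2 < p) (P : Measure Ω)
    [IsProbabilityMeasure P] (B : Finset ι) {Φ : ι → Ω → ℝ} (hJ : HasGaussianLaw (fun ω (b : B) => Φ b ω) P)
    (hΦ : ∀ b ∈ B, Measurable (Φ b)) {c : ι → ℝ} {c₀ : ℝ} (hc₀ : 0 < c₀) (hcb : ∀ b ∈ B, c₀ ≤ c b) {ek : ℝ} (hek : 0 < ek) :
    ∀ i, 1 ≤ i → Tendsto (fun t => ∫ ω, |iteratedDeriv i (fun s => ∏ b ∈ B, cutoff χ (c b * pLog p (s * ek)) (Φ b ω)) t| ∂P)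
      (𝓝[>] (0 : ℝ)) (𝓝 0) := fun _ hi =>
  tendsto_integral_abs_iteratedDeriv_prod_cutoff_t_zero_of_hasGaussianLaw χ hp P B (BIJ88ZtPositivity308.hasGaussianLaw_of_joint P B hJ) hΦ
    hc₀ (fun b hb => (hcb b hb).trans (le_abs_self _)) hek hi

end Gaussian

/-! ## §4 `z_t > 0` for non-centred jointly Gaussian fields with means in the small-field box -/

section Positivity

variable {Ω : Type*} [MeasurableSpace Ω] (χ : CutoffProfile) {ι : Type*}

/-- **The small-field box has positive probability when it contains the mean vector**: for jointly Gaussian fields `Φ_b`, `b ∈ Λ`, with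
`|E Φ_b| < r` for all `b ∈ Λ`: `0 < P(∀ b ∈ Λ, |Φ_b| < r)` (gen 8's `BIJ88ZtPositivity308.measure_preimage_pos_of_hasGaussianLaw`: a Gaussian measure
charges every open set containing its mean). [cite: BalabanImbrieJaffe1988, (5.14.2) p.308] -/
theorem measureReal_smallBall_pos_of_hasGaussianLaw_mean (P : Measure Ω) [IsProbabilityMeasure P] (B : Finset ι) {Φ : ι → Ω → ℝ}
    (hJ : HasGaussianLaw (fun ω (b : B) => Φ b ω) P) (hΦ : ∀ b ∈ B, Measurable (Φ b)) {r : ℝ} (hm : ∀ b ∈ B, |P[Φ b]| < r) :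
    0 < P.real {ω | ∀ b ∈ B, |Φ b ω| < r} := by
  classical
  have hU : IsOpen {x : ↥B → ℝ | ∀ i, |x i| < r} := by
    rw [show {x : ↥B → ℝ | ∀ i, |x i| < r} = ⋂ i, {x | |x i| < r} by ext; simp]
    exact isOpen_iInter_of_finite fun i => isOpen_lt (continuous_abs.comp (continuous_apply i)) continuous_const
  have h := BIJ88ZtPositivity308.measure_preimage_pos_of_hasGaussianLaw P (X := fun (b : B) ω => Φ b ω) hJ (fun b => hΦ b b.2) hU
    (show (fun i : ↥B => P[fun ω => Φ i ω]) ∈ {x : ↥B → ℝ | ∀ i, |x i| < r} from fun i => hm i i.2)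
  have hset : {ω | ∀ b ∈ B, |Φ b ω| < r} = (fun ω (b : B) => Φ b ω) ⁻¹' {x : ↥B → ℝ | ∀ i, |x i| < r} := by
    ext ω
    simp only [Set.mem_setOf_eq, Set.mem_preimage, Subtype.forall]
  rw [hset]
  exact ENNReal.toReal_pos h.ne' (measure_ne_top P _)

/-- **`z_t > 0` on the whole branch for jointly Gaussian fields with means in the small-field box** (`χ ≥ 0`, `p ≥ 0`, `c_b ≥ c₀ > 0`,
`|E Φ_b| < (9/10)c₀`, measurable `|W| ≤ K`, `0 < t`, `te_k ≤ e^{−1}`): the interacting expectation `⟨·⟩_t` of p. 308 is well defined without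
centring. [cite: BalabanImbrieJaffe1988, (5.14.2) p.308] -/
theorem integral_restrictedInteraction_pos_of_mean (hχ : ∀ x, 0 ≤ χ.χ₁ x) {p : ℝ} (hp : 0 ≤ p) (P : Measure Ω) [IsProbabilityMeasure P]
    (B : Finset ι) {Φ : ι → Ω → ℝ} (hJ : HasGaussianLaw (fun ω (b : B) => Φ b ω) P) (hΦ : ∀ b ∈ B, Measurable (Φ b))
    {c : ι → ℝ} {c₀ : ℝ} (hc₀ : 0 < c₀) (hcb : ∀ b ∈ B, c₀ ≤ c b) (hm : ∀ b ∈ B, |P[Φ b]| < 9 / 10 * c₀) {W : Ω → ℝ}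
    (hW : Measurable W) {K : ℝ} (hK : ∀ ω, |W ω| ≤ K) {ek : ℝ} (hek : 0 < ek) {t : ℝ} (ht : 0 < t) (h1 : t * ek ≤ Real.exp (-1)) :
    0 < ∫ ω, (∏ b ∈ B, cutoff χ (c b * pLog p (t * ek)) (Φ b ω)) * Real.exp (-(t * W ω)) ∂P :=
  BIJ88ZtPositivity308.integral_restrictedInteraction_pos_of_smallBall χ hχ hp P B hΦ hc₀ hcb hW hK hek
    (measureReal_smallBall_pos_of_hasGaussianLaw_mean P B hJ hΦ hm) ht h1

/-- … hence `z_t ≠ 0` on `(0,1]` for `e_k ≤ e^{−1}` (the hypothesis `hz` of the p. 308 chain, without centring).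
[cite: BalabanImbrieJaffe1988, (5.14.2) p.308] -/
theorem integral_restrictedInteraction_ne_zero_Ioc_of_mean (hχ : ∀ x, 0 ≤ χ.χ₁ x) {p : ℝ} (hp : 0 ≤ p) (P : Measure Ω)
    [IsProbabilityMeasure P] (B : Finset ι) {Φ : ι → Ω → ℝ} (hJ : HasGaussianLaw (fun ω (b : B) => Φ b ω) P)
    (hΦ : ∀ b ∈ B, Measurable (Φ b)) {c : ι → ℝ} {c₀ : ℝ} (hc₀ : 0 < c₀) (hcb : ∀ b ∈ B, c₀ ≤ c b)
    (hm : ∀ b ∈ B, |P[Φ b]| < 9 / 10 * c₀) {W : Ω → ℝ} (hW : Measurable W) {K : ℝ} (hK : ∀ ω, |W ω| ≤ K) {ek : ℝ} (hek : 0 < ek)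
    (hek1 : ek ≤ Real.exp (-1)) :
    ∀ t ∈ Set.Ioc (0 : ℝ) 1, (∫ ω, (∏ b ∈ B, cutoff χ (c b * pLog p (t * ek)) (Φ b ω)) * Real.exp (-(t * W ω)) ∂P) ≠ 0 :=
  fun _t ht => (integral_restrictedInteraction_pos_of_mean χ hχ hp P B hJ hΦ hc₀ hcb hm hW hK hek ht.1
    (BIJ88ZtPositivity308.mul_le_exp_neg_one_of_Ioc hek hek1 ht)).ne'

end Positivity

end Literature.MathematicalPhysics.QuantumFieldTheory.BalabanImbrieJaffe1984to88.BIJ88GaussShellNoncentred309
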